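import Literature.AlgebraicGeometry.Resolution.MonomializationAlongValuation
import Literature.AlgebraicGeometry.Resolution.DecompositionLayerFrame
import Literature.AlgebraicGeometry.Resolution.ValueGroupRelations
import Literature.AlgebraicGeometry.Resolution.ArithmeticalThreefoldsMonomials
import Literature.AlgebraicGeometry.Resolution.RegularSystemOfParameters
import HarnessLib

/-!
# The rational rank of the valuation is at most `3`: at most three elements of `S` have independent values

Topic: `Literature/AlgebraicGeometry/Resolution`. PROOF side of `CossartPiltant2019ReductionP`
(`ArithmeticalThreefoldsLocal.lean`), input (C4), [CoP1] Prop. 8.1 (V. Cossart, O. Piltant,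
HAL hal-00139124, p. 22: "rational rank `r` (`1 ≤ r ≤ 3`)"). In the frame of the chain
(`S` excellent regular local of dimension three, `E ⊇ S` algebraic, `O_E` dominating `S` with
residue field algebraic over that of `S`) the rational rank of `v` is at most `3`; in print this
is Abhyankar's inequality. Here it is PROVED, in the multiplicative form used by
`exists_maximal_independent_family` (`ValueGroupRank.lean`), from the embedded-resolution
hypothesis `hEmb` of the chain (Cossart–Jannsen–Saito) via monomialization
(`exists_localRing_monomial_of_embeddedResolution`): finitely many nonzero elements
`s₁, …, s_k` of `S` become units times monomials in the three regular parameters of a local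
uniformization monomializing their product, so their values are monomials in three values,
and more than three of them are multiplicatively dependent
(`exists_relation_of_spanning_family`): `card_le_three_of_independent`.

Everything is PROVED; no named facts, definitions, instances or notation are introduced
(`hEmb` is the hypothesis of the chain, passed through).

## Sources

* V. Cossart, O. Piltant, J. Algebra 320 (2008) 1051–1082: Prop. 8.1 (HAL hal-00139124,
  p. 22). [CossartPiltant2008]
* V. Cossart, U. Jannsen, S. Saito (2020): Cor. 1.5 (the hypothesis `hEmb`). [CossartJannsenSaito2020]
-/

noncomputable section

open AlgebraicGeometry CategoryTheory

namespace Literature.AlgebraicGeometry.Resolution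

universe u

open IsLocalRing _root_.Polynomial Function

section RankBound

variable {S : Type u} [CommRing S] [IsRegularLocalRing S] {E : Type u} [Field E] [Algebra S E]
  [Algebra.IsAlgebraic S E]

set_option maxHeartbeats 1600000 in
/-- **Rational rank at most three** ([CoP1] Prop. 8.1: "`1 ≤ r ≤ 3`"), multiplicative form:
in the frame of the chain, if `s₁, …, s_k ∈ S` are nonzero with multiplicatively independent
values (`∏ v(sᵢ)^{pᵢ} = ∏ v(sᵢ)^{mᵢ} ⇒ p = m`), then `k ≤ 3`. Proof by monomialization of
`∏ sᵢ` in a local uniformization (hypothesis `hEmb`).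
[cite: CossartPiltant2008, Prop. 8.1 (HAL p. 22)] [cite: CossartJannsenSaito2020, Cor. 1.5] -/
theorem card_le_three_of_independent
    (hEmb : ∀ (Z : Scheme.{u}) [IsIntegral Z] [IsNoetherian Z], Scheme.IsRegular Z →
      Scheme.IsExcellent Z → ∀ (X : Set Z), IsClosed X → X ≠ Set.univ → topologicalKrullDim X ≤ 2 →
        ∃ (Z' : Scheme.{u}) (π : Z' ⟶ Z), IsProper π ∧ Function.Surjective π.base ∧
          (∃ U : Z.Opens, (U : Set Z) = Xᶜ ∧ IsIso (π ∣_ U)) ∧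
          IsStrictNormalCrossingsDivisor Z' (π.base ⁻¹' X))
    (hexc : IsExcellentRing S) (hSdim : ringKrullDim S = 3)
    (hinj : Function.Injective (algebraMap S E))
    (OE : ValuationSubring E) (hSO : ∀ s : S, algebraMap S E s ∈ OE)
    (hdom : ∀ s ∈ maximalIdeal S, OE.valuation (algebraMap S E s) < 1)
    (hres : ∀ y : OE, ∃ q : S[X], (∃ i, q.coeff i ∉ maximalIdeal S) ∧
      OE.valuation (q.eval₂ (algebraMap S E) y) < 1)
    (k : ℕ) (s : Fin k → S) (hs0 : ∀ i, s i ≠ 0)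
    (hind : ∀ p m : Fin k → ℕ,
      ∏ i, OE.valuation (algebraMap S E (s i)) ^ p i =
        ∏ i, OE.valuation (algebraMap S E (s i)) ^ m i → p = m) :
    k ≤ 3 := by
  classical
  haveI : IsDomain S := isDomain_of_isRegularLocalRing S
  rcases Nat.eq_zero_or_pos k with hk | hk
  · omega
  -- domination as an iff
  have hRm : ∀ r : S, r ∈ maximalIdeal S ↔ OE.valuation (algebraMap S E r) < 1 := by
    intro r
    refine ⟨hdom r, fun hlt => ?_⟩
    by_contra hr
    have hu : IsUnit r := by
      by_contra hnu; exact hr ((IsLocalRing.mem_maximalIdeal _).mpr hnu)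
    obtain ⟨c, hc⟩ := hu.exists_right_inv
    have h1 : OE.valuation (algebraMap S E r) * OE.valuation (algebraMap S E c) = 1 := by
      rw [← map_mul, ← map_mul, hc, map_one, map_one]
    have hle : OE.valuation (algebraMap S E c) ≤ 1 := (OE.valuation_le_one_iff _).mpr (hSO c)
    have : OE.valuation (algebraMap S E r) * OE.valuation (algebraMap S E c) < 1 * 1 :=
      mul_lt_mul_of_lt_of_le_of_nonneg_of_pos hlt hle zero_le zero_lt_one
    rw [h1, one_mul] at this
    exact lt_irrefl _ this
  -- all `sᵢ` lie in `𝔪_S` (an element of value `0` alone is dependent)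
  have hsm : ∀ i, s i ∈ maximalIdeal S := by
    intro i
    by_contra hi
    have hv1 : OE.valuation (algebraMap S E (s i)) = 1 :=
      le_antisymm ((OE.valuation_le_one_iff _).mpr (hSO _)) (not_lt.mp fun h => hi ((hRm _).mpr h))
    have := hind (Function.update 0 i 1) 0 (by
      refine Finset.prod_congr rfl fun j _ => ?_
      by_cases hj : j = i
      · subst hj; rw [Function.update_self, hv1, one_pow, Pi.zero_apply, pow_zero]
      · rw [Function.update_of_ne hj])
    have h1 := congr_fun this i
    rw [Function.update_self, Pi.zero_apply] at h1
    exact one_ne_zero h1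
  -- monomialize the product
  obtain ⟨i₀⟩ : Nonempty (Fin k) := ⟨⟨0, hk⟩⟩
  set xR : S := ∏ i, s i with hxR
  have hxR0 : xR ≠ 0 := Finset.prod_ne_zero_iff.mpr fun i _ => hs0 i
  have hxRm : xR ∈ maximalIdeal S := by
    rw [hxR, ← Finset.mul_prod_erase _ _ (Finset.mem_univ i₀)]
    exact Ideal.mul_mem_right _ _ (hsm i₀)
  obtain ⟨uu, -, huuO, R', _, _, _, hR'inj, hR'O, hR'm, hrange, hfrac, d, z, α, u, hu, hdimR',
    hz, hxmono⟩ :=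
    exists_localRing_monomial_of_embeddedResolution hEmb (K := E) (E := E) hinj hexc hSdim OE hSO
      hRm xR hxR0 hxRm
  haveI : IsDomain R' := isDomain_of_isRegularLocalRing R'
  -- the `sᵢ` in `R'`
  have hsR' : ∀ i, ∃ s' : R', algebraMap R' E s' = algebraMap S E (s i) := fun i => by
    obtain ⟨s', hs'⟩ := hrange _ ((Algebra.adjoin S (uu : Set E)).algebraMap_mem (s i))
    exact ⟨s', hs'⟩
  choose s' hs' using hsR'
  have hprod : ∏ i, s' i = u * ∏ c, z c ^ α c := by
    apply hR'inj
    rw [map_prod, ← hxmono]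
    simp only [hs']
    rw [← map_prod, ← hxR]
  -- the `z_c` are prime
  have hd : (maximalIdeal R').spanFinrank = d := by
    have h := IsRegularLocalRing.spanFinrank_maximalIdeal (R := R')
    rw [hdimR'] at h
    exact_mod_cast h
  have hz0 : ∀ c, z c ≠ 0 := fun c h0 => by
    have := not_mem_span_image_of_not_mem hd z hz (S := ∅) (i := c) (Set.notMem_empty c)
    apply this
    rw [h0]
    exact Ideal.zero_mem _
  have hprime : ∀ c, Prime (z c) := fun c => by
    have h := isPrime_span_image hd z hz {c}
    rw [Finset.coe_singleton, Set.image_singleton] at h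
    exact (Ideal.span_singleton_prime (hz0 c)).mp h
  -- each `sᵢ` is a unit times a monomial in `z`
  have hval1 : ∀ w : R', IsUnit w → OE.valuation (algebraMap R' E w) = 1 := fun w hw =>
    le_antisymm ((OE.valuation_le_one_iff _).mpr (hR'O w))
      (not_lt.mp fun h => (hR'm w).mpr h |> fun hm =>
        (IsLocalRing.mem_maximalIdeal _).mp hm hw)
  have hmono : ∀ i, ∃ a : Fin d → ℕ, OE.valuation (algebraMap S E (s i)) =
      ∏ c, OE.valuation (algebraMap R' E (z c)) ^ a c := by
    intro i
    have hdvd : s' i ∣ ∏ c, z c ^ α c := by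
      have h1 : s' i ∣ ∏ j, s' j := Finset.dvd_prod_of_mem _ (Finset.mem_univ i)
      rw [hprod] at h1
      obtain ⟨c, hc⟩ := h1
      obtain ⟨ui, hui⟩ := hu.exists_left_inv
      refine ⟨c * ui, ?_⟩
      calc ∏ c, z c ^ α c = ui * u * ∏ c, z c ^ α c := by rw [hui, one_mul]
        _ = ui * (s' i * c) := by rw [mul_assoc, hc]
        _ = s' i * (c * ui) := by ring
    obtain ⟨γ, a, hγa⟩ := CossartPiltantMonomial.exists_eq_units_mul_prod_pow_of_dvd hprime α hdvd
    refine ⟨a, ?_⟩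
    rw [← hs' i, hγa, map_mul, map_prod, map_mul, hval1 _ γ.isUnit, one_mul, map_prod]
    exact Finset.prod_congr rfl fun c _ => by rw [map_pow, map_pow]
  choose a ha using hmono
  -- more than `d` of them would be dependent
  have hkd : k ≤ d := by
    by_contra hlt
    rw [not_le] at hlt
    obtain ⟨c, -, hc0, hrel⟩ :=
      exists_relation_of_spanning_family OE (fun c => algebraMap R' E (z c))
        (fun c h0 => hz0 c (hR'inj (by rw [h0, map_zero]))) (Finset.univ : Finset (Fin k))
        (fun i => algebraMap S E (s i)) (by rw [Finset.card_univ, Fintype.card_fin]; exact hlt)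
        (fun i h0 => hs0 i (hinj (by rw [h0, map_zero])))
        (fun i => ⟨1, a i, 0, one_pos, by
          rw [pow_one, ha i]
          simp only [Pi.zero_apply, pow_zero, Finset.prod_const_one, mul_one]⟩)
    have h := hind _ _ hrel
    apply hc0
    funext i
    have hi := congr_fun h i
    have := Int.toNat_sub_toNat_neg (c i)
    simp only [Pi.zero_apply]
    omega
  -- `d = dim R' = dim S = 3`: `R'` is the local ring of the model `S[uu]` at the centre
  have hT : (Algebra.adjoin S (uu : Set E)).toSubring ≤ OE.toSubring := fun y hy => huuO y hy
  let φ : R' →+* locAtCentre (Algebra.adjoin S (uu : Set E)).toSubring OE :=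
    (algebraMap R' E).codRestrict _ (fun r => by
      obtain ⟨τ, σ, hτ, hσ, hvσ, hr⟩ := hfrac r
      refine ⟨τ, hτ, σ, hσ, hvσ, ?_⟩
      rw [eq_div_iff (ne_zero_of_valuation_eq_one hvσ), hr])
  have hφinj : Function.Injective φ := fun a b h => hR'inj (congrArg Subtype.val h)
  have hφsurj : Function.Surjective φ := by
    rintro ⟨y, τ, hτ, σ, hσ, hvσ, rfl⟩
    obtain ⟨τ', hτ'⟩ := hrange τ hτ
    obtain ⟨σ', hσ'⟩ := hrange σ hσ
    have hσu : IsUnit σ' := by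
      by_contra hnu
      have hm : σ' ∈ maximalIdeal R' := (IsLocalRing.mem_maximalIdeal _).mpr hnu
      have := (hR'm σ').mp hm
      rw [hσ', hvσ] at this
      exact lt_irrefl _ this
    obtain ⟨σi, hσi⟩ := hσu.exists_right_inv
    refine ⟨τ' * σi, Subtype.ext ?_⟩
    change algebraMap R' E (τ' * σi) = τ / σ
    have hσ0 : σ ≠ 0 := ne_zero_of_valuation_eq_one hvσ
    have hσiE : algebraMap R' E σi = σ⁻¹ := by
      have h1 : algebraMap R' E σ' * algebraMap R' E σi = 1 := by rw [← map_mul, hσi, map_one]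
      rw [hσ'] at h1
      exact (eq_inv_of_mul_eq_one_right h1)
    rw [map_mul, hτ', hσiE, div_eq_mul_inv]
  have hdimloc : ringKrullDim (locAtCentre (Algebra.adjoin S (uu : Set E)).toSubring OE) = 3 := by
    haveI : Algebra.FiniteType S (Algebra.adjoin S (uu : Set E)) :=
      (Subalgebra.fg_iff_finiteType _).mp (Subalgebra.fg_adjoin_finset _)
    rw [ringKrullDim_locAtCentre_eq_of_frame hexc.isUniversallyCatenaryRing hinj OE hSO hdom hres
      (Algebra.adjoin S (uu : Set E)) hT, hSdim]
  have hd3 : (d : WithBot ℕ∞) = 3 := by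
    rw [← hdimR', ringKrullDim_eq_of_ringEquiv (RingEquiv.ofBijective φ ⟨hφinj, hφsurj⟩), hdimloc]
  have hd3' : d = 3 := by exact_mod_cast hd3
  omega

end RankBound

end Literature.AlgebraicGeometry.Resolution

end
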